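import Summits.Ventures.CertifiedQuantumChemistry.Rows.HubbardRingTVDoublonBound
import Summits.Ventures.CertifiedQuantumChemistry.Rows.ConjectureSU
import Literature.MathematicalPhysics.QuantumChemistry.SingletRestrictedRelaxation
import Mathlib.Topology.Order.OrderClosed
import HarnessLib

/-!
# Ventures/CertifiedQuantumChemistry — Rows/StrongCouplingScaledGapBound.lean: THE SCALED VALUE AND
# THE SCALED GAP ARE BOUNDED UNIFORMLY IN `U` — `−C²/4 ≤ U·(OPT_X − E_core)` on every half-filled
# Hubbard-type table, and `0 ≤ ĉ_X(2n;U) ≤ (2n)³` for the conjecture leaf's scaled gap at both levels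

HONEST FRAMING (verbatim): certified bounds for a stated model Hamiltonian in a stated basis; not a
claim about the real molecule beyond that model. Nothing here is a state, a row, a claim node or a
value of record; the statements are A-PRIORI BOUNDS on the optimal values of the two-positivity
relaxations (`pqgSectorEnergy`, `pqgSingletEnergy`) of Hubbard-type integral tables and of the cell's
test-vector models `hubbardRingTV L t U`, and on the scaled gap of the conjecture leaf
`Rows/ConjectureSU2.lean` — whose clauses (existence of the limit, its values) are UNTOUCHED: a bounded
function need not converge.

Seat rdm-B (gen 36), zero compute; theorems only (no `def`). Fourth file of the step-(1) set
(`Rows/StrongCouplingBookkeeping` gen 21, `Rows/StrongCouplingDoublonBound` +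
`Rows/HubbardRingTVDoublonBound` gen 35, `Rows/StrongCouplingEntryBounds` + `Rows/StrongCouplingBudgetBounds`
gen 36). Two words-grade sentences of `STRUCTURE.md` are typed here:

* LEMMA S-1 (i)(c) (§2.3, paper grade, "offered for attack"): "`ĉ_X` is BOUNDED (`0 ≤ ĉ_X ≤ K_L²/16`
  by `OPT_X ≥ min_d (U d − K_L√d) = −K_L²/(4U)`)" — with this seat's cruder hop constant
  `C = 4|t|L√L` (every ordered pair of sites charged, not only bonds) in place of `K_L`;
* CLAIM N / LEMMA GL's standing premise that the SCALED VALUE `U·OPT_X(L;U)` stays in a fixed compact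
  interval along `U → ∞` (step (1) for the objective).

Contents:
* §1 `StrongCouplingGap.neg_sq_div_le` — the scalar step `−C²/(4U) ≤ U·s − C·√s` (`U > 0`, `s ≥ 0`;
  complete the square).
* §2 every Hubbard-type table (`h_pp = 0`, `‖h_pq‖ ≤ τ`, `(pq|rs) = U·[p = q = r = s]`, `U > 0`, scalar
  `E_core`) at half filling `a + b = |Λ| ≥ 2`: `re_rdmEnergy_ge_sub` (`Re E(γ, Γ) ≥ Re E_core − C²/(4U)`
  on every feasible pair, `C = 4τ|Λ|√|Λ|`, from gen 35's `re_rdmEnergy_ge`) and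
  **`sub_le_pqgSectorEnergy`** (`Re E_core − C²/(4U) ≤ E_PQG(a, b)`).
* §3 the TV-H files: **`hubbardRingTV_pqgSectorEnergy_ge`** (`−4t²L³/U ≤ E_PQG^sector`),
  `hubbardRingTV_pqgSingletEnergy_ge` (the singlet-restricted value is larger), and
  `hubbardRingTV_mul_pqgSectorEnergy_mem_Icc` (`U·E_PQG^sector ∈ [−4t²L³, 0]` — the scaled value is
  bounded, both ends typed).
* §4 THE CONJECTURE LEAF'S SCALED GAP (its own spelling: `t = 1`, `L = 2n`, `U ∈ ℚ`,
  `(U/4)·(Model.energy F n n − Model.pqgSectorEnergy F n n)` resp. `− Model.pqgSingletEnergy F n`,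
  `F = hubbardRingTV (2n) 1 U`): **`scaledGap_sector_mem_Icc`** and **`scaledGap_singlet_mem_Icc`** —
  for every `n ≥ 1` and `U > 0`, `0 ≤ ĉ_X(2n;U) ≤ (2n)³` at both levels (`≥ 0`: the relaxation is below
  the sector energy, `pqgSectorEnergy_le_sectorGroundEnergy`, and at the singlet level below the singlet
  energy which EQUALS the sector energy by the Lieb bridge `hubbardRingTV_singletEnergy_eq_energy`;
  `≤ (2n)³`: `E₀ ≤ 0` at half filling, gen 35's `hubbardRingTV_sectorGroundEnergy_le_zero`, and §3);
  `limit_mem_Icc_of_tendsto` — hence ANY limit the scaled gap may have along `U → ∞` lies in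
  `[0, (2n)³]`: the constants `c n` of `ConjectureSU2_DQG` / `ConjectureSU2_DQGS2`, IF they exist, are a
  priori `≤ (2n)³` (the conjecture itself — existence, values, monotonicity — is neither used nor
  advanced).

Everything is PROVED (0 sorry), standard axioms; no definitions, no named facts; no claim node, hint,
row or CERTIFIED cell depends on it. References (docstring-only): E. H. Lieb, Phys. Rev. Lett. 62
(1989) 1201, Thm 2 (the tree's `LiebHalfFilled.exists_unit_groundState`, via the bridge file);
D. A. Mazziotti, Adv. Chem. Phys. 134 (2007) ch. 3 §II.B, §II.F; the rest is elementary.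
-/

noncomputable section

namespace Summit.Ventures.CertifiedQuantumChemistry

open Matrix Finset
open Literature.MathematicalPhysics.QuantumLattice Literature.MathematicalPhysics.QuantumChemistry
open scoped ComplexOrder

namespace StrongCouplingGap

/-! ### §1 The scalar step: complete the square -/

/-- **`−C²/(4U) ≤ U·s − C·√s`** for `U > 0`, `s ≥ 0`: `U·(U s − C√s) + C²/4 = (U√s − C/2)² ≥ 0`. The
words' "`OPT_X ≥ min_d (U d − K_L√d) = −K_L²/(4U)`". [folklore] -/
theorem neg_sq_div_le {U C s : ℝ} (hU : 0 < U) (hs : 0 ≤ s) :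
    -(C ^ 2 / (4 * U)) ≤ U * s - C * Real.sqrt s := by
  obtain ⟨r, hr, rfl⟩ : ∃ r : ℝ, 0 ≤ r ∧ s = r ^ 2 :=
    ⟨Real.sqrt s, Real.sqrt_nonneg _, (Real.sq_sqrt hs).symm⟩
  rw [Real.sqrt_sq hr]
  have h1 : -(C ^ 2 / (4 * U)) = -(C ^ 2 / 4) / U := by
    field_simp
  rw [h1, div_le_iff₀ hU]
  nlinarith [sq_nonneg (U * r - C / 2)]

/-! ### §2 Every half-filled Hubbard-type table: the relaxation value is `≥ E_core − C²/(4U)` -/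

section Table

variable {Λ : Type*} [LinearOrder Λ] [Fintype Λ] {a b : ℕ}
variable {γ : Matrix (Orb Λ) (Orb Λ) ℂ} {Γ : Matrix (Orb Λ × Orb Λ) (Orb Λ × Orb Λ) ℂ}

/-- **`Re E(γ, Γ) ≥ Re E_core − C²/(4U)`** with `C = 4τ|Λ|√|Λ|`, for every feasible pair of the
`D, Q, G` sector programme of a half-filled Hubbard-type table (`a + b = |Λ| ≥ 2`, `h_pp = 0`,
`‖h_pq‖ ≤ τ`, `(pq|rs) = U·[p = q = r = s]`, `U > 0`): gen 35's
`StrongCouplingDoublon.re_rdmEnergy_ge` (`≥ Re E_core + U·s − C√s`) and §1. [folklore] -/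
theorem re_rdmEnergy_ge_sub (hf : IsDQGFeasibleSector a b γ Γ) (hN : a + b = Fintype.card Λ)
    (hΛ : 2 ≤ Fintype.card Λ) {h : Λ → Λ → ℂ} {τ : ℝ} (hτ : ∀ p q, ‖h p q‖ ≤ τ)
    (hdiag : ∀ p, h p p = 0) {U : ℝ} (hU : 0 < U) {g : Λ → Λ → Λ → Λ → ℂ}
    (hg : ∀ p q r s, g p q r s = if p = q ∧ q = r ∧ r = s then (U : ℂ) else 0) (hnuc : ℂ) :
    hnuc.re - (4 * τ * Fintype.card Λ * Real.sqrt (Fintype.card Λ)) ^ 2 / (4 * U)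
      ≤ (rdmEnergy h g hnuc γ Γ).re := by
  have hb := StrongCouplingDoublon.re_rdmEnergy_ge hf hN hΛ hτ hdiag U hg hnuc
  have hs0 : 0 ≤ ∑ p : Λ, (Γ (orb p 0, orb p 1) (orb p 0, orb p 1)).re :=
    sum_nonneg fun p _ =>
      (Complex.nonneg_iff.1 (hf.dqg.d_psd.diag_nonneg (i := (orb p 0, orb p 1)))).1
  have hsq := neg_sq_div_le (C := 4 * τ * Fintype.card Λ * Real.sqrt (Fintype.card Λ)) hU hs0
  linarith

/-- **THE RELAXATION VALUE IS BOUNDED BELOW UNIFORMLY**: `Re E_core − C²/(4U) ≤ E_PQG(a, b)` for every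
half-filled Hubbard-type table with `U > 0` (`le_pqgSectorEnergy_iff`: a number below the functional on
the whole feasible set is below the value). Hence `U·(E_PQG − Re E_core) ≥ −C²/4` for all `U > 0`.
[folklore] -/
theorem sub_le_pqgSectorEnergy (hN : a + b = Fintype.card Λ) (hΛ : 2 ≤ Fintype.card Λ)
    {h : Λ → Λ → ℂ} {τ : ℝ} (hτ : ∀ p q, ‖h p q‖ ≤ τ) (hdiag : ∀ p, h p p = 0) {U : ℝ} (hU : 0 < U)
    {g : Λ → Λ → Λ → Λ → ℂ}
    (hg : ∀ p q r s, g p q r s = if p = q ∧ q = r ∧ r = s then (U : ℂ) else 0) (hnuc : ℂ) :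
    hnuc.re - (4 * τ * Fintype.card Λ * Real.sqrt (Fintype.card Λ)) ^ 2 / (4 * U)
      ≤ pqgSectorEnergy h g hnuc a b :=
  (le_pqgSectorEnergy_iff h g hnuc (by omega) (by omega)).2
    fun _ _ hf => re_rdmEnergy_ge_sub hf hN hΛ hτ hdiag hU hg hnuc

end Table

/-! ### §3 The TV-H files: `−4t²L³/U ≤ E_PQG ≤ 0`, so `U·E_PQG ∈ [−4t²L³, 0]` -/

section TVH

open Summit.Ventures.CertifiedQuantumChemistry.Hamiltonians

/-- The TV-H hop constant squared: `(4|t|L√L)² / (4U) = 4t²L³/U`. (plumbing) [folklore] -/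
theorem tvh_const_sq_div (L : ℕ) (t : ℚ) {U : ℚ} (hU : 0 < U) :
    (4 * |(t : ℝ)| * L * Real.sqrt L) ^ 2 / (4 * U) = 4 * (t : ℝ) ^ 2 * (L : ℝ) ^ 3 / U := by
  have hL : Real.sqrt (L : ℝ) ^ 2 = L := Real.sq_sqrt (Nat.cast_nonneg _)
  have hU' : (U : ℝ) ≠ 0 := by exact_mod_cast hU.ne'
  rw [mul_pow, mul_pow, mul_pow, hL, sq_abs]
  field_simp

/-- **`−4t²L³/U ≤ E_PQG^sector(a, b)`** on `hubbardRingTV L t U` at half filling `a + b = L ≥ 2`,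
`U > 0`: the value of the `D, Q, G` sector programme is bounded below by `−C²/(4U)`, `C = 4|t|L√L`
(`E_core = 0`). [folklore] -/
theorem hubbardRingTV_pqgSectorEnergy_ge {L : ℕ} (hL : 2 ≤ L) (t : ℚ) {U : ℚ} (hU : 0 < U)
    {a b : ℕ} (hN : a + b = L) :
    -(4 * (t : ℝ) ^ 2 * (L : ℝ) ^ 3 / U) ≤
      pqgSectorEnergy (fun p q => ((hubbardRingTV L t U).h p q : ℂ))
        (fun p q r s => ((hubbardRingTV L t U).eri p q r s : ℂ))
        ((hubbardRingTV L t U).ecore : ℂ) a b := by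
  have hcard : a + b = Fintype.card (Fin L) := by rw [Fintype.card_fin]; exact hN
  have hΛ : 2 ≤ Fintype.card (Fin L) := by rw [Fintype.card_fin]; exact hL
  have hU' : (0 : ℝ) < (U : ℝ) := by exact_mod_cast hU
  have hb := sub_le_pqgSectorEnergy hcard hΛ (StrongCouplingDoublon.norm_hubbardRingTV_h_le L t U)
    (StrongCouplingDoublon.hubbardRingTV_h_diag L t U) hU' (StrongCouplingDoublon.hubbardRingTV_eri L t U)
    ((hubbardRingTV L t U).ecore : ℂ)
  have hcore : (((hubbardRingTV L t U).ecore : ℚ) : ℂ).re = 0 := by simp [hubbardRingTV]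
  rw [hcore, Fintype.card_fin, tvh_const_sq_div L t hU, zero_sub] at hb
  exact hb

/-- **`−4t²L³/U ≤ E_PQG^singlet(2n, S = 0)`** on `hubbardRingTV (2n) t U` (`n ≥ 1`, `U > 0`): the
singlet-restricted value is above the `(n, n)` sector value (`pqgSectorEnergy_le_pqgSingletEnergy`).
[folklore] -/
theorem hubbardRingTV_pqgSingletEnergy_ge {n : ℕ} (hn : 1 ≤ n) (t : ℚ) {U : ℚ} (hU : 0 < U) :
    -(4 * (t : ℝ) ^ 2 * ((2 * n : ℕ) : ℝ) ^ 3 / U) ≤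
      pqgSingletEnergy (fun p q => ((hubbardRingTV (2 * n) t U).h p q : ℂ))
        (fun p q r s => ((hubbardRingTV (2 * n) t U).eri p q r s : ℂ))
        ((hubbardRingTV (2 * n) t U).ecore : ℂ) n :=
  (hubbardRingTV_pqgSectorEnergy_ge (by omega) t hU (by omega : n + n = 2 * n)).trans
    (pqgSectorEnergy_le_pqgSingletEnergy _ _ _ (by rw [Fintype.card_fin]; omega))

/-- **THE SCALED VALUE IS BOUNDED**: `U·E_PQG^sector(a, b) ∈ [−4t²L³, 0]` on `hubbardRingTV L t U` at
half filling `a + b = L ≥ 2`, for every `U > 0` — the premise of CLAIM N step (1) / LEMMA GL for the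
objective ("`OPT ≤ E₀ ≤ 0`" and "`OPT ≥ −C√(Σd) + U·Σd ≥ −C²/(4U)`"), both ends kernel-checked
(upper end: gen 35's `hubbardRingTV_pqgSectorEnergy_le_zero`). [folklore] -/
theorem hubbardRingTV_mul_pqgSectorEnergy_mem_Icc {L : ℕ} (hL : 2 ≤ L) (t : ℚ) {U : ℚ}
    (hU : 0 < U) {a b : ℕ} (hN : a + b = L) :
    (U : ℝ) * pqgSectorEnergy (fun p q => ((hubbardRingTV L t U).h p q : ℂ))
        (fun p q r s => ((hubbardRingTV L t U).eri p q r s : ℂ))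
        ((hubbardRingTV L t U).ecore : ℂ) a b ∈ Set.Icc (-(4 * (t : ℝ) ^ 2 * (L : ℝ) ^ 3)) 0 := by
  have hU' : (0 : ℝ) < (U : ℝ) := by exact_mod_cast hU
  have hlo := hubbardRingTV_pqgSectorEnergy_ge hL t hU hN
  have hhi := StrongCouplingDoublon.hubbardRingTV_pqgSectorEnergy_le_zero t U hN
  refine ⟨?_, mul_nonpos_iff.2 (Or.inl ⟨hU'.le, hhi⟩)⟩
  have h1 : (U : ℝ) * -(4 * (t : ℝ) ^ 2 * (L : ℝ) ^ 3 / U) = -(4 * (t : ℝ) ^ 2 * (L : ℝ) ^ 3) := by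
    field_simp
  rw [← h1]
  exact mul_le_mul_of_nonneg_left hlo hU'.le

end TVH

/-! ### §4 The conjecture leaf's scaled gap is bounded: `0 ≤ ĉ_X(2n;U) ≤ (2n)³` -/

section Leaf

open Summit.Ventures.CertifiedQuantumChemistry.Hamiltonians

/-- **`0 ≤ ĉ_DQG(2n;U) ≤ (2n)³`** in the leaf's spelling: for `n ≥ 1` and `U > 0`,
`(U/4)·(Model.energy F n n − Model.pqgSectorEnergy F n n) ∈ [0, (2n)³]`, `F = hubbardRingTV (2n) 1 U`.
Lower end: the relaxation is below the sector energy (`pqgSectorEnergy_le_sectorGroundEnergy`). Upper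
end: `E₀(n, n) ≤ 0` at half filling and `E_PQG ≥ −4·(2n)³/U` (§3 at `t = 1`), so the gap is
`≤ (U/4)·4(2n)³/U = (2n)³`. LEMMA S-1 (i)(c)'s boundedness clause, level DQG. [folklore] -/
theorem scaledGap_sector_mem_Icc {n : ℕ} (hn : 1 ≤ n) {U : ℚ} (hU : 0 < U) :
    ((U : ℝ) / 4) * (Model.energy (hubbardRingTV (2 * n) 1 U) n n -
        Model.pqgSectorEnergy (hubbardRingTV (2 * n) 1 U) n n) ∈ Set.Icc (0 : ℝ) ((2 * n : ℕ) ^ 3) := by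
  have hU' : (0 : ℝ) < (U : ℝ) := by exact_mod_cast hU
  have hnk : n ≤ Fintype.card (Fin (2 * n)) := by rw [Fintype.card_fin]; omega
  have hle : Model.pqgSectorEnergy (hubbardRingTV (2 * n) 1 U) n n ≤
      Model.energy (hubbardRingTV (2 * n) 1 U) n n :=
    pqgSectorEnergy_le_sectorGroundEnergy (hubbardRingTV_hamiltonian_isHermitian (2 * n) 1 U) hnk hnk
  have hE : Model.energy (hubbardRingTV (2 * n) 1 U) n n ≤ 0 :=
    StrongCouplingDoublon.hubbardRingTV_sectorGroundEnergy_le_zero 1 U (by omega : n + n = 2 * n)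
  have hP : -(4 * ((1 : ℚ) : ℝ) ^ 2 * ((2 * n : ℕ) : ℝ) ^ 3 / U) ≤
      Model.pqgSectorEnergy (hubbardRingTV (2 * n) 1 U) n n :=
    hubbardRingTV_pqgSectorEnergy_ge (by omega) 1 hU (by omega : n + n = 2 * n)
  refine ⟨mul_nonneg (by positivity) (sub_nonneg.2 hle), ?_⟩
  calc ((U : ℝ) / 4) * (Model.energy (hubbardRingTV (2 * n) 1 U) n n -
        Model.pqgSectorEnergy (hubbardRingTV (2 * n) 1 U) n n)
      ≤ ((U : ℝ) / 4) * (4 * ((2 * n : ℕ) : ℝ) ^ 3 / U) := by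
        refine mul_le_mul_of_nonneg_left ?_ (by positivity)
        simp only [Rat.cast_one, one_pow, mul_one] at hP
        linarith
    _ = ((2 * n : ℕ) : ℝ) ^ 3 := by field_simp

/-- **`0 ≤ ĉ_DQG+S²(2n;U) ≤ (2n)³`** in the leaf's spelling: for `n ≥ 1` and `U > 0`,
`(U/4)·(Model.energy F n n − Model.pqgSingletEnergy F n) ∈ [0, (2n)³]`, `F = hubbardRingTV (2n) 1 U`.
Lower end: the singlet-restricted relaxation is below the singlet energy
(`pqgSingletEnergy_le_minEnergyOn_singlet`), which EQUALS the `(n, n)` sector energy on the repulsive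
half-filled even ring (the Lieb bridge `hubbardRingTV_singletEnergy_eq_energy`, unconditional). Upper
end: the singlet value is above the sector value. LEMMA S-1 (i)(c)'s boundedness clause, level
DQG+S². [folklore] -/
theorem scaledGap_singlet_mem_Icc {n : ℕ} (hn : 1 ≤ n) {U : ℚ} (hU : 0 < U) :
    ((U : ℝ) / 4) * (Model.energy (hubbardRingTV (2 * n) 1 U) n n -
        Model.pqgSingletEnergy (hubbardRingTV (2 * n) 1 U) n) ∈ Set.Icc (0 : ℝ) ((2 * n : ℕ) ^ 3) := by
  have hU' : (0 : ℝ) < (U : ℝ) := by exact_mod_cast hU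
  have hnk : n ≤ Fintype.card (Fin (2 * n)) := by rw [Fintype.card_fin]; omega
  have h1 : Model.pqgSingletEnergy (hubbardRingTV (2 * n) 1 U) n ≤
      (hubbardRingTV (2 * n) 1 U).singletEnergy n :=
    pqgSingletEnergy_le_minEnergyOn_singlet _ _ _ hnk
  have h2 : (hubbardRingTV (2 * n) 1 U).singletEnergy n = (hubbardRingTV (2 * n) 1 U).energy n n :=
    hubbardRingTV_singletEnergy_eq_energy (by omega) one_ne_zero hU
  have h3 : Model.pqgSectorEnergy (hubbardRingTV (2 * n) 1 U) n n ≤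
      Model.pqgSingletEnergy (hubbardRingTV (2 * n) 1 U) n :=
    pqgSectorEnergy_le_pqgSingletEnergy _ _ _ hnk
  obtain ⟨-, hhi⟩ := scaledGap_sector_mem_Icc hn hU
  refine ⟨mul_nonneg (by positivity) (sub_nonneg.2 (h1.trans h2.le)), le_trans ?_ hhi⟩
  exact mul_le_mul_of_nonneg_left (by linarith) (by positivity)

/-- **ANY LIMIT OF THE SCALED GAP LIES IN `[0, (2n)³]`.** If a function of `U ∈ ℚ` takes values in
`[0, (2n)³]` for all `U > 0` and tends to `c` along `U → ∞`, then `c ∈ [0, (2n)³]` (closed interval).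
With `scaledGap_sector_mem_Icc` / `scaledGap_singlet_mem_Icc`: the constants `c n` of
`ConjectureSU2_DQG` / `ConjectureSU2_DQGS2`, IF they exist, are a priori at most `(2n)³` — nothing about
their existence or value is claimed. [folklore] -/
theorem limit_mem_Icc_of_tendsto {n : ℕ} {f : ℚ → ℝ} {c : ℝ}
    (hf : ∀ U : ℚ, 0 < U → f U ∈ Set.Icc (0 : ℝ) ((2 * n : ℕ) ^ 3))
    (hc : Filter.Tendsto f Filter.atTop (nhds c)) : c ∈ Set.Icc (0 : ℝ) ((2 * n : ℕ) ^ 3) :=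
  isClosed_Icc.mem_of_tendsto hc
    (Filter.eventually_atTop.2 ⟨1, fun U hU => hf U (lt_of_lt_of_le one_pos hU)⟩)

/-- The DQG instance: every limit of `ĉ_DQG(2n;·)` along `U → ∞` (`n ≥ 1`) lies in `[0, (2n)³]`.
[folklore] -/
theorem scaledGap_sector_limit_mem_Icc {n : ℕ} (hn : 1 ≤ n) {c : ℝ}
    (hc : Filter.Tendsto (fun U : ℚ => ((U : ℝ) / 4) *
        (Model.energy (hubbardRingTV (2 * n) 1 U) n n -
          Model.pqgSectorEnergy (hubbardRingTV (2 * n) 1 U) n n)) Filter.atTop (nhds c)) :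
    c ∈ Set.Icc (0 : ℝ) ((2 * n : ℕ) ^ 3) :=
  limit_mem_Icc_of_tendsto (fun _ hU => scaledGap_sector_mem_Icc hn hU) hc

/-- The DQG+S² instance: every limit of `ĉ_DQG+S²(2n;·)` along `U → ∞` (`n ≥ 1`) lies in
`[0, (2n)³]`. [folklore] -/
theorem scaledGap_singlet_limit_mem_Icc {n : ℕ} (hn : 1 ≤ n) {c : ℝ}
    (hc : Filter.Tendsto (fun U : ℚ => ((U : ℝ) / 4) *
        (Model.energy (hubbardRingTV (2 * n) 1 U) n n -
          Model.pqgSingletEnergy (hubbardRingTV (2 * n) 1 U) n)) Filter.atTop (nhds c)) :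
    c ∈ Set.Icc (0 : ℝ) ((2 * n : ℕ) ^ 3) :=
  limit_mem_Icc_of_tendsto (fun _ hU => scaledGap_singlet_mem_Icc hn hU) hc

end Leaf

end StrongCouplingGap

end Summit.Ventures.CertifiedQuantumChemistry
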